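import Summits.CriticalPhenomena.PercolationContinuityZ3.Theorems.Transplant.FKConnectivityAllQForestContractionMono
import Summits.CriticalPhenomena.PercolationContinuityZ3.Theorems.Transplant.FKConnectivityAllQForestAdjacentTwoSumSameSideFibres
import Summits.CriticalPhenomena.PercolationContinuityZ3.Theorems.Transplant.FKConnectivityAllQForestAdjacentPathGadgetReglue
import HarnessLib

/-!
# The ONE-EDGE DECOMPOSITION of the square-free adjacent forest Rayleigh margin, the node (★) `HubPairOneClassOn`
# (one-class hub-pair positivity, NOT asserted) and the kernel reduction (★) ⇒ `AdjForestRayleighNoSqOn`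

Support file (`--supports stmt-CriticalPhenomena-4575`), FK sub-lane `prim-bschramm-fk-1` (gen 25) of the post-continuity programme;
builds on p205010 (kernel theorem, internal audit signed; external expert review pending).  Two definitions (one event, one
`@[conjecture]`-shaped counting node with its `Pos` form — NOT asserted), no named facts, no sorries; standard axioms.

THE NODE (♣)⁰ = `AdjForestRayleighNoSqOn V`: on every fibre `(M, u₀)` (`ω ∖ M = u₀`; first class `ω ⊇ u₀`, second class `ω ∆ M ⊇ u₀`)
and all `e = ov`, `f = oy` (`v ≠ y`): `bad := #(Fo ∩ {e,f ∈ ω}, Fo) ≤ good := #(Fo ∩ {e ∈ ω}, Fo ∩ {f ∈ ω})`.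

THE ONE-EDGE DECOMPOSITION (memo bschramm/FROM-fk-1-g25-HUB-PAIR-DECOMPOSITION.md §1).  Fix a further pair `h = xw ∉ N ∪ u`, `x ≠ w`.
Split the colourings of the fibre `(N ∪ {h}, u)` by the class of `h`, and the colourings of `(N, u)` by the TYPE of `(x, w)`:
`x ~ w` in neither class / in the first only / in the second only / in both.  `h` may join a class iff that class does not already join
`x, w` (`isForestCfg_insert_iff`), so (with `R := {x ~ w}`):
* **`fibreCount_insert_free_forest_split`**: `#_{(N+h,u)}(Fo ∩ P, Fo ∩ Q) = 2·#_{(N,u+h)}(Fo ∩ P, Fo ∩ Q) + #_{(N,u)}(Fo ∩ P ∩ R, Fo ∩ Q ∩ Rᶜ)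
  + #_{(N,u)}(Fo ∩ P ∩ Rᶜ, Fo ∩ Q ∩ R)` for all events `P, Q` insensitive to `h` — the type-0 colourings are exactly those of the PINNED
  fibre `(N, u ∪ {h})` (`fibreCount_insert_pinned`), counted twice (`h` may go to either class), the one-class types once.
* **`adjForestNoSq_bad_split`**, **`adjForestNoSq_good_split`**: `bad(N+h,u) = 2·bad(N,u+h) + sRR + sBB`, `good(N+h,u) = 2·good(N,u+h) + dRB + dBR`,
  where on the type "first class joins `x,w`, second does not": `sRR = #(e,f both first)`, `sBB = #(both second)`, `dRB = #(e first, f second)`,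
  `dBR = #(f first, e second)` (the second-class-only type is carried over by the involution `fibreCount_swap`).  Hence
  **`margin(N+h,u) = 2·margin(N,u+h) + s_A(N,u;x,w)`**, `s_A := dRB + dBR − sRR − sBB` — in graph language
  `(Diff − Same)(G) = 2·(Diff − Same)(G/h) + 2·s_A(G − h; x,w)` for every edge `h = xw ∉ {e,f}` of a multigraph `G`.
  (This identity is the algebra behind g24's contraction monotonicity `CM ⟺ s₀ + 2s_A ≥ 0` and its n = 9 refutation.)

NEW NODE (★) — ONE-CLASS HUB-PAIR POSITIVITY `HubPairOneClassOn V` (NOT asserted): for every fibre, all `o, v ≠ y` and EVERY vertex `a`: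
`sRR + sBB ≤ dRB + dBR` on the type "`a` reachable from `o` in the first class but not in the second", i.e. `s_A(G; o,a) ≥ 0` when the pair
is `(o, a)` with `o` THE HUB ITSELF.  EVIDENCE (exact, exhaustive, two independent engines numerics/starcm/{satype.c, fblib.py} agree on n ≤ 6):
0 failures over every connected simple graph with ≤ 9 vertices, every `(o,e,f)` and every vertex `a` (n = 9: 18,702,912 tests; the three other
type-sums `s₀` (= margin of `G/{o~a}`), `s_B = s_A`, `s_AB` are ALSO ≥ 0 in all of them — "hub-pair decomposition positivity"), and over
253,882 random multigraph tests (n ≤ 8, parallel pairs); kit censuses n = 10, 11 pending at writing.  For pairs `{x,w} ∌ o` the analogous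
`s_A` IS negative often (n = 9: 104,379 of 5,798,396 far pairs; the n = 9 witness of `…ForestContractionMonoCex` has `s_A = −6`).
* **`adjForestRayleighNoSqOn_of_hubPairOneClass : HubPairOneClassOn V → AdjForestRayleighNoSqOn V`** (KERNEL): strong induction on the
  number of free pairs.  If some free pair `h = xw ∉ {e,f}` (non-diagonal) has an endpoint `x` joined to `o` by PINNED pairs (a "star pair of
  the quotient"), the decomposition at `h` gives `margin(M,u₀) = 2·margin(M∖h, u₀+h) + s_A(M∖h,u₀; x,w)`, the first term is `≥ 0` by induction
  and the second is (★) at `a := w` (reachability from `x` = reachability from `o`, both classes containing `u₀`).  If no such pair exists,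
  `ω ↦ ω ∖ {f}` injects bad into good: the second class cannot join `o` to `y` because every second-class pair at the pinned cluster of `o`
  is pinned (`reachable_pinned_of_closed`), and a pinned `o–y` path would close a cycle with `f` in the first class.  Diagonal pairs and the
  degenerate positions of `e, f` are the trivial equalities of `…ForestContractionMono`.
* **`adjForestRayleighNoSqPos_of_hubPairOneClassPos`**.
So (♣)⁰ — hence adjacent-edge negative correlation of the arboreal gas / of uniform forest 2-colourings on every finite graph — follows from
the positivity of ONE of the four type-sums at pairs `(o, a)` through the hub; equivalently `margin(G) ≥ 2·margin(G/oa)` for star edges.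
[cite: SempleWelsh2008, Conj. 1.1 (p. 2); Thm. 4.2 (p. 11)] [cite: CibulkaHladkyLaCroixWagner2008, Thm. 1 (p. 2)] [cite: Linusson2011, Prop. 2.6]
[cite: Grimmett2006, §1.5 (p. 13)]
-/

noncomputable section

namespace Summit.CriticalPhenomena.PercolationContinuityZ3.Theorems
namespace FK

open MeasureTheory Set Literature.Probability.LatticeModels Literature.Probability.Percolation
open scoped Classical symmDiff

variable {V : Type*} [Fintype V]

/-- The event "`x` is joined to `w` by an open path of the configuration". [cite: Grimmett2006, §1.5 (p. 13)] -/
def reachEv (x w : V) : Set (BondConfig V) := {ω | (openGraph ω).Reachable x w}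

omit [Fintype V] in
/-- Membership in `reachEv`. [folklore] -/
@[simp] theorem mem_reachEv {x w : V} {ω : BondConfig V} : ω ∈ reachEv x w ↔ (openGraph ω).Reachable x w := Iff.rfl

/-- **ONE-CLASS HUB-PAIR POSITIVITY (★) on the vertex type `V`**: for every fibre `(M, u₀)`, all `o`, `v ≠ y` and every vertex `a`, among the
colourings of the fibre in which `a` is reachable from `o` in the first class `ω` but not in the second class `ω ∆ M`:
`#(e,f ∈ first) + #(e,f ∈ second) ≤ #(e ∈ first, f ∈ second) + #(f ∈ first, e ∈ second)` (`e = ov`, `f = oy`).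
CONJECTURE-SHAPED COUNTING STATEMENT, NOT asserted. [cite: SempleWelsh2008, Conj. 1.1 (p. 2)] [cite: Linusson2011, Prop. 2.6] -/
def HubPairOneClassOn (V : Type*) [Fintype V] : Prop :=
  ∀ (M u₀ : BondConfig V), Disjoint u₀ M → ∀ (o v y a : V), v ≠ y →
    fibreCount M u₀ (forestEv V ∩ {ω | s(o, v) ∈ ω ∧ s(o, y) ∈ ω} ∩ reachEv o a) (forestEv V ∩ (reachEv o a)ᶜ) +
        fibreCount M u₀ (forestEv V ∩ reachEv o a) (forestEv V ∩ {ω | s(o, v) ∈ ω ∧ s(o, y) ∈ ω} ∩ (reachEv o a)ᶜ) ≤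
      fibreCount M u₀ (forestEv V ∩ {ω | s(o, v) ∈ ω} ∩ reachEv o a) (forestEv V ∩ {ω | s(o, y) ∈ ω} ∩ (reachEv o a)ᶜ) +
        fibreCount M u₀ (forestEv V ∩ {ω | s(o, y) ∈ ω} ∩ reachEv o a) (forestEv V ∩ {ω | s(o, v) ∈ ω} ∩ (reachEv o a)ᶜ)

/-- **One-class hub-pair positivity on every finite vertex type.**  CONJECTURE-SHAPED, NOT asserted (evidence in the module docstring:
every graph with ≤ 9 vertices, every vertex `a`). [cite: SempleWelsh2008, Conj. 1.1 (p. 2); Thm. 4.2 (p. 11)] -/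
@[conjecture] def HubPairOneClassPos : Prop := ∀ n : ℕ, HubPairOneClassOn (Fin n)

/-! ### Fibre-count plumbing -/

/-- Additivity in the second event for disjoint events. [cite: Linusson2011, Prop. 2.6] -/
theorem fibreCount_split_right (M u : BondConfig V) (A : Set (BondConfig V)) {B₁ B₂ : Set (BondConfig V)} (hd : Disjoint B₁ B₂) :
    fibreCount M u A (B₁ ∪ B₂) = fibreCount M u A B₁ + fibreCount M u A B₂ := by
  rw [fibreCount_swap, fibreCount_split_left M u A hd, fibreCount_swap M u B₁, fibreCount_swap M u B₂]

omit [Fintype V] in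
/-- A pair outside `N ∪ u` lies in no configuration of the fibre `(N, u)` and in no partner. [folklore] -/
theorem notMem_and_notMem_symmDiff_of_fibre {N u ω : BondConfig V} {h : Sym2 V} (hN : h ∉ N) (hu : h ∉ u) (hω : ω \ N = u) :
    h ∉ ω ∧ h ∉ ω ∆ N := by
  have hsub := subset_union_of_fibre hω
  exact ⟨fun hh => (hsub.1 hh).elim hN hu, fun hh => (hsub.2 hh).elim hN hu⟩

omit [Fintype V] in
/-- Inserting the non-diagonal pair `xw ∉ ω`: `ω ∪ {xw}` is a forest configuration iff `ω` is one not joining `x` to `w`.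
[cite: Grimmett2006, §1.5 (p. 13)] -/
theorem insert_mem_forestEv_iff {x w : V} (hxw : x ≠ w) {ω : BondConfig V} (hh : s(x, w) ∉ ω) :
    insert s(x, w) ω ∈ forestEv V ↔ ω ∈ forestEv V ∧ ω ∉ reachEv x w :=
  isForestCfg_insert_iff hxw hh

/-! ### The one-edge decomposition -/

section Split

variable {N u : BondConfig V} {x w : V} {P Q : Set (BondConfig V)}

/-- **THE ONE-EDGE DECOMPOSITION of a forest fibre count.**  For a non-diagonal pair `h = xw ∉ N ∪ u` and events `P, Q` insensitive to `h`:
`#_{(N+h,u)}(Fo ∩ P, Fo ∩ Q) = 2·#_{(N,u+h)}(Fo ∩ P, Fo ∩ Q) + #_{(N,u)}(Fo ∩ P ∩ {x~w}, Fo ∩ Q ∩ {x≁w}) + #_{(N,u)}(Fo ∩ P ∩ {x≁w}, Fo ∩ Q ∩ {x~w})`.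
[cite: Linusson2011, Prop. 2.6] [cite: Grimmett2006, §1.5 (p. 13)] -/
theorem fibreCount_insert_free_forest_split (hxw : x ≠ w) (hN : s(x, w) ∉ N) (hu : s(x, w) ∉ u)
    (hP : ∀ ω : BondConfig V, s(x, w) ∉ ω → (insert s(x, w) ω ∈ P ↔ ω ∈ P))
    (hQ : ∀ ω : BondConfig V, s(x, w) ∉ ω → (insert s(x, w) ω ∈ Q ↔ ω ∈ Q)) :
    fibreCount (insert s(x, w) N) u (forestEv V ∩ P) (forestEv V ∩ Q) =
      2 * fibreCount N (insert s(x, w) u) (forestEv V ∩ P) (forestEv V ∩ Q) +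
        fibreCount N u (forestEv V ∩ P ∩ reachEv x w) (forestEv V ∩ Q ∩ (reachEv x w)ᶜ) +
        fibreCount N u (forestEv V ∩ P ∩ (reachEv x w)ᶜ) (forestEv V ∩ Q ∩ reachEv x w) := by
  set h := s(x, w) with hh
  -- the pinned fibre = type 0
  have hpin : fibreCount N (insert h u) (forestEv V ∩ P) (forestEv V ∩ Q) =
      fibreCount N u (forestEv V ∩ P ∩ (reachEv x w)ᶜ) (forestEv V ∩ Q ∩ (reachEv x w)ᶜ) := by
    rw [fibreCount_insert_pinned hN hu]
    refine fibreCount_congr_fibre N u fun ω hω => ?_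
    have hno := notMem_and_notMem_symmDiff_of_fibre hN hu hω
    have h1 := insert_mem_forestEv_iff hxw hno.1
    have h2 := insert_mem_forestEv_iff hxw hno.2
    have h3 := hP ω hno.1
    have h4 := hQ (ω ∆ N) hno.2
    simp only [mem_setOf_eq, mem_inter_iff, mem_compl_iff]
    tauto
  -- split by the class of `h`
  rw [fibreCount_insert_one hN]
  have hterm1 : fibreCount N u ({ω | h ∉ ω} ∩ {ω | insert h ω ∈ forestEv V ∩ P}) ({ω | h ∉ ω} ∩ (forestEv V ∩ Q)) =
      fibreCount N u (forestEv V ∩ P ∩ (reachEv x w)ᶜ) (forestEv V ∩ Q) := by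
    refine fibreCount_congr_fibre N u fun ω hω => ?_
    have hno := notMem_and_notMem_symmDiff_of_fibre hN hu hω
    have h1 := insert_mem_forestEv_iff hxw hno.1
    have h3 := hP ω hno.1
    simp only [mem_setOf_eq, mem_inter_iff, mem_compl_iff]
    tauto
  have hterm2 : fibreCount N u ({ω | h ∉ ω} ∩ (forestEv V ∩ P)) ({ω | h ∉ ω} ∩ {ω | insert h ω ∈ forestEv V ∩ Q}) =
      fibreCount N u (forestEv V ∩ P) (forestEv V ∩ Q ∩ (reachEv x w)ᶜ) := by
    refine fibreCount_congr_fibre N u fun ω hω => ?_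
    have hno := notMem_and_notMem_symmDiff_of_fibre hN hu hω
    have h2 := insert_mem_forestEv_iff hxw hno.2
    have h4 := hQ (ω ∆ N) hno.2
    simp only [mem_setOf_eq, mem_inter_iff, mem_compl_iff]
    tauto
  rw [hterm1, hterm2, hpin]
  -- split the unconstrained classes by the type
  have hQsplit : forestEv V ∩ Q = (forestEv V ∩ Q ∩ (reachEv x w)ᶜ) ∪ (forestEv V ∩ Q ∩ reachEv x w) := by
    rw [← inter_union_distrib_left, compl_union_self, inter_univ]
  have hPsplit : forestEv V ∩ P = (forestEv V ∩ P ∩ (reachEv x w)ᶜ) ∪ (forestEv V ∩ P ∩ reachEv x w) := by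
    rw [← inter_union_distrib_left, compl_union_self, inter_univ]
  have hdQ : Disjoint (forestEv V ∩ Q ∩ (reachEv x w)ᶜ) (forestEv V ∩ Q ∩ reachEv x w) :=
    Set.disjoint_left.2 fun ω h₁ h₂ => h₁.2 h₂.2
  have hdP : Disjoint (forestEv V ∩ P ∩ (reachEv x w)ᶜ) (forestEv V ∩ P ∩ reachEv x w) :=
    Set.disjoint_left.2 fun ω h₁ h₂ => h₁.2 h₂.2
  have s1 : fibreCount N u (forestEv V ∩ P ∩ (reachEv x w)ᶜ) (forestEv V ∩ Q) =
      fibreCount N u (forestEv V ∩ P ∩ (reachEv x w)ᶜ) (forestEv V ∩ Q ∩ (reachEv x w)ᶜ) +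
        fibreCount N u (forestEv V ∩ P ∩ (reachEv x w)ᶜ) (forestEv V ∩ Q ∩ reachEv x w) := by
    rw [← fibreCount_split_right N u _ hdQ, ← hQsplit]
  have s2 : fibreCount N u (forestEv V ∩ P) (forestEv V ∩ Q ∩ (reachEv x w)ᶜ) =
      fibreCount N u (forestEv V ∩ P ∩ (reachEv x w)ᶜ) (forestEv V ∩ Q ∩ (reachEv x w)ᶜ) +
        fibreCount N u (forestEv V ∩ P ∩ reachEv x w) (forestEv V ∩ Q ∩ (reachEv x w)ᶜ) := by
    rw [← fibreCount_split_left N u _ hdP, ← hPsplit]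
  rw [s1, s2]
  ring

variable {e f : Sym2 V}

/-- **`bad(N+h, u) = 2·bad(N, u+h) + sRR + sBB`** (the both-second type-A count `sBB` is moved to the first slot by the involution).
[cite: SempleWelsh2008, Conj. 1.1 (p. 2)] [cite: Linusson2011, Prop. 2.6] -/
theorem adjForestNoSq_bad_split (hxw : x ≠ w) (hN : s(x, w) ∉ N) (hu : s(x, w) ∉ u) (he : s(x, w) ≠ e) (hf : s(x, w) ≠ f) :
    fibreCount (insert s(x, w) N) u (forestEv V ∩ {ω | e ∈ ω ∧ f ∈ ω}) (forestEv V) =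
      2 * fibreCount N (insert s(x, w) u) (forestEv V ∩ {ω | e ∈ ω ∧ f ∈ ω}) (forestEv V) +
        fibreCount N u (forestEv V ∩ {ω | e ∈ ω ∧ f ∈ ω} ∩ reachEv x w) (forestEv V ∩ (reachEv x w)ᶜ) +
        fibreCount N u (forestEv V ∩ reachEv x w) (forestEv V ∩ {ω | e ∈ ω ∧ f ∈ ω} ∩ (reachEv x w)ᶜ) := by
  have hP : ∀ ω : BondConfig V, s(x, w) ∉ ω → (insert s(x, w) ω ∈ {ω : BondConfig V | e ∈ ω ∧ f ∈ ω} ↔ ω ∈ {ω | e ∈ ω ∧ f ∈ ω}) := by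
    intro ω _
    simp only [mem_setOf_eq, mem_insert_iff]
    constructor
    · rintro ⟨h1 | h1, h2 | h2⟩
      · exact absurd h1.symm he
      · exact absurd h1.symm he
      · exact absurd h2.symm hf
      · exact ⟨h1, h2⟩
    · rintro ⟨h1, h2⟩; exact ⟨Or.inr h1, Or.inr h2⟩
  have hQ : ∀ ω : BondConfig V, s(x, w) ∉ ω → (insert s(x, w) ω ∈ (univ : Set (BondConfig V)) ↔ ω ∈ (univ : Set (BondConfig V))) :=
    fun _ _ => by simp only [mem_univ]
  have hmain := fibreCount_insert_free_forest_split (P := {ω | e ∈ ω ∧ f ∈ ω}) (Q := univ) hxw hN hu hP hQ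
  simp only [inter_univ] at hmain
  rw [hmain, fibreCount_swap N u (forestEv V ∩ {ω | e ∈ ω ∧ f ∈ ω} ∩ (reachEv x w)ᶜ)]

/-- **`good(N+h, u) = 2·good(N, u+h) + dRB + dBR`**. [cite: SempleWelsh2008, Conj. 1.1 (p. 2)] [cite: Linusson2011, Prop. 2.6] -/
theorem adjForestNoSq_good_split (hxw : x ≠ w) (hN : s(x, w) ∉ N) (hu : s(x, w) ∉ u) (he : s(x, w) ≠ e) (hf : s(x, w) ≠ f) :
    fibreCount (insert s(x, w) N) u (forestEv V ∩ {ω | e ∈ ω}) (forestEv V ∩ {ω | f ∈ ω}) =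
      2 * fibreCount N (insert s(x, w) u) (forestEv V ∩ {ω | e ∈ ω}) (forestEv V ∩ {ω | f ∈ ω}) +
        fibreCount N u (forestEv V ∩ {ω | e ∈ ω} ∩ reachEv x w) (forestEv V ∩ {ω | f ∈ ω} ∩ (reachEv x w)ᶜ) +
        fibreCount N u (forestEv V ∩ {ω | f ∈ ω} ∩ reachEv x w) (forestEv V ∩ {ω | e ∈ ω} ∩ (reachEv x w)ᶜ) := by
  have hP : ∀ ω : BondConfig V, s(x, w) ∉ ω → (insert s(x, w) ω ∈ {ω : BondConfig V | e ∈ ω} ↔ ω ∈ {ω | e ∈ ω}) := by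
    intro ω _
    simp only [mem_setOf_eq, mem_insert_iff]
    exact ⟨fun h1 => h1.resolve_left (fun h' => he h'.symm), Or.inr⟩
  have hQ : ∀ ω : BondConfig V, s(x, w) ∉ ω → (insert s(x, w) ω ∈ {ω : BondConfig V | f ∈ ω} ↔ ω ∈ {ω | f ∈ ω}) := by
    intro ω _
    simp only [mem_setOf_eq, mem_insert_iff]
    exact ⟨fun h1 => h1.resolve_left (fun h' => hf h'.symm), Or.inr⟩
  rw [fibreCount_insert_free_forest_split hxw hN hu hP hQ,
    fibreCount_swap N u (forestEv V ∩ {ω | e ∈ ω} ∩ (reachEv x w)ᶜ)]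

end Split

/-! ### Reachability relative to the pinned pairs -/

section Pinned

variable {u₀ ω : BondConfig V} {o x a : V}

omit [Fintype V] in
/-- If `x` is joined to `o` by pinned pairs then, in any configuration containing the pinned pairs, `a` is reachable from `o` iff from `x`.
[folklore] -/
theorem reachable_iff_of_pinned_reachable (hsub : u₀ ⊆ ω) (hox : (openGraph u₀).Reachable o x) :
    (openGraph ω).Reachable o a ↔ (openGraph ω).Reachable x a := by
  have hox' : (openGraph ω).Reachable o x := hox.mono (openGraph_mono hsub)
  exact ⟨fun h => hox'.symm.trans h, fun h => hox'.trans h⟩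

omit [Fintype V] in
/-- **Closure**: if every non-diagonal pair of `ω` with an endpoint in the pinned cluster of `o` is pinned, then the `ω`-cluster of `o` is its
pinned cluster. [folklore] -/
theorem reachable_pinned_of_closed (hclosed : ∀ p ∈ ω, ¬ p.IsDiag → ∀ z ∈ p, (openGraph u₀).Reachable o z → p ∈ u₀) {a : V}
    (h : (openGraph ω).Reachable o a) : (openGraph u₀).Reachable o a := by
  obtain ⟨p⟩ := h
  suffices H : ∀ (b z : V) (q : (openGraph ω).Walk b z), (openGraph u₀).Reachable o b → (openGraph u₀).Reachable o z from
    H o a p (SimpleGraph.Reachable.refl _)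
  intro b z q
  induction q with
  | nil => exact id
  | @cons b c d hadj q' ih =>
    intro hb
    have hbc := (openGraph_adj ω b c).1 hadj
    have hne : b ≠ c := hbc.2
    have hnd : ¬ (s(b, c)).IsDiag := fun hd => hne (Sym2.mk_isDiag_iff.1 hd)
    have hpin : s(b, c) ∈ u₀ := hclosed _ hbc.1 hnd b (Sym2.mem_mk_left _ _) hb
    have hstep : (openGraph u₀).Adj b c := (openGraph_adj u₀ b c).2 ⟨hpin, hne⟩
    exact ih (hb.trans hstep.reachable)

end Pinned

/-! ### (★) ⇒ the node -/

section Main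

/-- The type-restricted counts at a pair `(x, w)` whose first point is joined to `o` by pinned pairs are the counts at `(o, w)`.
[cite: Linusson2011, Prop. 2.6] -/
theorem fibreCount_reach_congr_of_pinned {M u₀ : BondConfig V} (hd : Disjoint u₀ M) {o x w : V}
    (hox : (openGraph u₀).Reachable o x) (P Q : Set (BondConfig V)) :
    fibreCount M u₀ (P ∩ reachEv x w) (Q ∩ (reachEv x w)ᶜ) = fibreCount M u₀ (P ∩ reachEv o w) (Q ∩ (reachEv o w)ᶜ) := by
  refine fibreCount_congr_fibre M u₀ fun ω hω => ?_
  have hsub : u₀ ⊆ ω := fun p hp => by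
    have hp' : p ∈ ω \ M := by rw [hω]; exact hp
    exact hp'.1
  have hsub' : u₀ ⊆ ω ∆ M := fun p hp =>
    Set.mem_symmDiff.2 (Or.inl ⟨hsub hp, fun hpM => hd.le_bot ⟨hp, hpM⟩⟩)
  have h1 := reachable_iff_of_pinned_reachable (a := w) hsub hox
  have h2 := reachable_iff_of_pinned_reachable (a := w) hsub' hox
  simp only [mem_inter_iff, mem_compl_iff, mem_reachEv]
  rw [h1, h2]

/-- **ONE-CLASS HUB-PAIR POSITIVITY ⇒ THE SQUARE-FREE ADJACENT FOREST RAYLEIGH NODE.**  If (★) `HubPairOneClassOn V` holds then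
`bad ≤ good` on every fibre, i.e. `AdjForestRayleighNoSqOn V`: pin a star pair of the quotient (`margin = 2·margin(pinned) + s_A ≥ 0` by
induction and (★)), or, if there is none, inject bad into good by `ω ↦ ω ∖ {f}`.
[cite: SempleWelsh2008, Conj. 1.1 (p. 2)] [cite: CibulkaHladkyLaCroixWagner2008, Thm. 1 (p. 2)] [cite: Linusson2011, Prop. 2.6] -/
theorem adjForestRayleighNoSqOn_of_hubPairOneClass (h : HubPairOneClassOn V) : AdjForestRayleighNoSqOn V := by
  suffices H : ∀ (k : ℕ) (M u₀ : BondConfig V), M.ncard = k → Disjoint u₀ M → ∀ (o v y : V), v ≠ y →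
      fibreCount M u₀ (forestEv V ∩ {ω | s(o, v) ∈ ω ∧ s(o, y) ∈ ω}) (forestEv V) ≤
        fibreCount M u₀ (forestEv V ∩ {ω | s(o, v) ∈ ω}) (forestEv V ∩ {ω | s(o, y) ∈ ω}) from
    fun M u₀ hd o v y hvy => H _ M u₀ rfl hd o v y hvy
  intro k
  induction k using Nat.strong_induction_on with
  | _ k ih =>
    intro M u₀ hk hd o v y hvy
    have hef : s(o, v) ≠ s(o, y) := fun h' => hvy (Sym2.congr_right.1 h')
    by_cases heM : s(o, v) ∈ M
    · by_cases hfM : s(o, y) ∈ M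
      · by_cases hstar : ∃ p ∈ M, p ≠ s(o, v) ∧ p ≠ s(o, y) ∧ ¬ p.IsDiag ∧ ∃ z ∈ p, (openGraph u₀).Reachable o z
        · -- A STAR PAIR OF THE QUOTIENT: decompose at it
          obtain ⟨p, hpM, hpe, hpf, hpd, z, hzp, hoz⟩ := hstar
          set w := Sym2.Mem.other hzp with hwdef
          have hp : s(z, w) = p := Sym2.other_spec hzp
          have hzw : z ≠ w := fun hzw => hpd (by rw [← hp]; exact Sym2.mk_isDiag_iff.2 hzw)
          set N := M \ {p} with hNdef
          have hpN : s(z, w) ∉ N := fun h' => h'.2 (by rw [hp]; rfl)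
          have hpu : s(z, w) ∉ u₀ := fun h' => hd.le_bot ⟨h', hp ▸ hpM⟩
          have hMN : M = insert s(z, w) N := by rw [hp, hNdef, insert_sdiff_singleton, insert_eq_of_mem hpM]
          have hpe' : s(z, w) ≠ s(o, v) := by rw [hp]; exact hpe
          have hpf' : s(z, w) ≠ s(o, y) := by rw [hp]; exact hpf
          have hbad := adjForestNoSq_bad_split (u := u₀) (e := s(o, v)) (f := s(o, y)) hzw hpN hpu hpe' hpf'
          have hgood := adjForestNoSq_good_split (u := u₀) (e := s(o, v)) (f := s(o, y)) hzw hpN hpu hpe' hpf'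
          -- induction hypothesis on the pinned fibre
          have hlt : N.ncard < k := by
            rw [← hk, hNdef]; exact Set.ncard_sdiff_singleton_lt_of_mem hpM
          have hdN : Disjoint u₀ N := hd.mono_right sdiff_subset
          have hd' : Disjoint (insert s(z, w) u₀) N := Set.disjoint_insert_left.2 ⟨hpN, hdN⟩
          have hih := ih _ hlt N (insert s(z, w) u₀) rfl hd' o v y hvy
          -- (★) at `a := w`, transported from the pair `(z, w)` to `(o, w)`
          have hstarw := h N u₀ hdN o v y w hvy
          have c1 := fibreCount_reach_congr_of_pinned hdN hoz (forestEv V ∩ {ω | s(o, v) ∈ ω ∧ s(o, y) ∈ ω}) (forestEv V) (w := w)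
          have c2 := fibreCount_reach_congr_of_pinned hdN hoz (forestEv V) (forestEv V ∩ {ω | s(o, v) ∈ ω ∧ s(o, y) ∈ ω}) (w := w)
          have c3 := fibreCount_reach_congr_of_pinned hdN hoz (forestEv V ∩ {ω | s(o, v) ∈ ω}) (forestEv V ∩ {ω | s(o, y) ∈ ω}) (w := w)
          have c4 := fibreCount_reach_congr_of_pinned hdN hoz (forestEv V ∩ {ω | s(o, y) ∈ ω}) (forestEv V ∩ {ω | s(o, v) ∈ ω}) (w := w)
          rw [hMN, hbad, hgood, c1, c2, c3, c4]
          omega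
        · -- NO STAR PAIR: `ω ↦ ω ∖ {f}` injects bad into good
          push Not at hstar
          by_cases hov : o = v
          · subst hov
            rw [fibreCount_eq_zero_of_forall _ _ _ _ fun ω _ hA _ => hA.1.1 _ hA.2.1 (Sym2.mk_isDiag_iff.2 rfl)]
            exact Nat.zero_le _
          by_cases hoy : o = y
          · subst hoy
            rw [fibreCount_eq_zero_of_forall _ _ _ _ fun ω _ hA _ => hA.1.1 _ hA.2.2 (Sym2.mk_isDiag_iff.2 rfl)]
            exact Nat.zero_le _
          have hfu : s(o, y) ∉ u₀ := fun h' => hd.le_bot ⟨h', hfM⟩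
          refine fibreCount_le_of_injOn (fun ω => ω \ {s(o, y)}) (fun ω hω hA hB => ?_) (fun ω ω' hω hA hB hω' hA' hB' hφ => ?_)
          · obtain ⟨hF, he, hf⟩ := hA
            have hsub : u₀ ⊆ ω := fun q hq => by
              have hq' : q ∈ ω \ M := by rw [hω]; exact hq
              exact hq'.1
            have hsub' : u₀ ⊆ ω ∆ M := fun q hq =>
              Set.mem_symmDiff.2 (Or.inl ⟨hsub hq, fun hqM => hd.le_bot ⟨hq, hqM⟩⟩)
            have hfB : s(o, y) ∉ ω ∆ M := fun h' => by
              rcases Set.mem_symmDiff.1 h' with h'' | h''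
              · exact h''.2 hfM
              · exact h''.2 hf
            have hpartner : (ω \ {s(o, y)}) ∆ M = insert s(o, y) (ω ∆ M) := by
              ext q
              constructor
              · intro hq
                rcases Set.mem_symmDiff.1 hq with ⟨⟨hqω, -⟩, hqM⟩ | ⟨hqM, hqn⟩
                · exact mem_insert_of_mem _ (Set.mem_symmDiff.2 (Or.inl ⟨hqω, hqM⟩))
                · by_cases hq' : q = s(o, y)
                  · rw [hq']; exact mem_insert _ _
                  · exact mem_insert_of_mem _ (Set.mem_symmDiff.2 (Or.inr ⟨hqM, fun hqω => hqn ⟨hqω, hq'⟩⟩))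
              · rintro (rfl | hq)
                · exact Set.mem_symmDiff.2 (Or.inr ⟨hfM, fun h' => h'.2 rfl⟩)
                · rcases Set.mem_symmDiff.1 hq with ⟨hqω, hqM⟩ | ⟨hqM, hqω⟩
                  · refine Set.mem_symmDiff.2 (Or.inl ⟨⟨hqω, fun hq' => hqM ?_⟩, hqM⟩)
                    rw [mem_singleton_iff.1 hq']; exact hfM
                  · exact Set.mem_symmDiff.2 (Or.inr ⟨hqM, fun h' => hqω h'.1⟩)
            -- the second class does not join `o` to `y`
            have hnot : ¬ (openGraph (ω ∆ M)).Reachable o y := by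
              intro hreach
              have hclosed : ∀ q ∈ ω ∆ M, ¬ q.IsDiag → ∀ z ∈ q, (openGraph u₀).Reachable o z → q ∈ u₀ := by
                intro q hq hqd z hz hoz
                rcases Set.mem_symmDiff.1 hq with hq' | hq'
                · have : q ∈ ω \ M := hq'
                  rw [hω] at this; exact this
                · exfalso
                  have hqe : q ≠ s(o, v) := fun h' => hq'.2 (h' ▸ he)
                  have hqf : q ≠ s(o, y) := fun h' => hq'.2 (h' ▸ hf)
                  exact hstar q hq'.1 hqe hqf hqd z hz hoz
              have hpin : (openGraph u₀).Reachable o y := reachable_pinned_of_closed hclosed hreach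
              have hforest : IsForestCfg (insert s(o, y) u₀) :=
                ⟨fun q hq => hF.1 q (by rcases hq with rfl | hq; exacts [hf, hsub hq]),
                  hF.2.anti (openGraph_mono (insert_subset hf hsub))⟩
              exact ((isForestCfg_insert_iff hoy hfu).1 hforest).2 hpin
            refine ⟨?_, ⟨⟨fun q hq => hF.1 q hq.1, hF.2.anti (openGraph_mono sdiff_subset)⟩, ⟨he, fun h' => hef h'⟩⟩, ?_⟩
            · rw [Set.sdiff_sdiff_comm, hω]; exact sdiff_singleton_eq_self hfu
            · rw [hpartner]
              exact ⟨(isForestCfg_insert_iff hoy hfB).2 ⟨hB, hnot⟩, mem_insert _ _⟩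
          · -- injectivity: both contain `f`
            have h1 : insert s(o, y) (ω \ {s(o, y)}) = ω := by rw [insert_sdiff_singleton, insert_eq_of_mem hA.2.2]
            have h2 : insert s(o, y) (ω' \ {s(o, y)}) = ω' := by rw [insert_sdiff_singleton, insert_eq_of_mem hA'.2.2]
            rw [← h1, ← h2, hφ]
      · -- `f` not free
        by_cases hfu : s(o, y) ∈ u₀
        · exact (adjForestNoSq_bad_eq_good_of_pinned' hd hfu).le
        · rw [adjForestNoSq_bad_eq_zero_of_notMem' hfM hfu]; exact Nat.zero_le _
    · -- `e` not free
      by_cases heu : s(o, v) ∈ u₀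
      · exact (adjForestNoSq_bad_eq_good_of_pinned hd heu).le
      · rw [adjForestNoSq_bad_eq_zero_of_notMem heM heu]; exact Nat.zero_le _

/-- **`HubPairOneClassPos → AdjForestRayleighNoSqPos`** (hence adjacent-edge negative correlation of the arboreal gas on every finite graph,
`ag_adjacent_negCorr_of_adjForestNoSq`). [cite: SempleWelsh2008, Conj. 1.1 (p. 2)] [cite: Grimmett2006, §1.5 (p. 13)] -/
theorem adjForestRayleighNoSqPos_of_hubPairOneClassPos (h : HubPairOneClassPos) : AdjForestRayleighNoSqPos :=
  fun n => adjForestRayleighNoSqOn_of_hubPairOneClass (h n)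

end Main

end FK
end Summit.CriticalPhenomena.PercolationContinuityZ3.Theorems

end
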